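import Mathlib.LinearAlgebra.Dual.Lemmas
import Mathlib.LinearAlgebra.FiniteDimensional.Lemmas
import Mathlib.FieldTheory.Finiteness
import Mathlib.Algebra.BigOperators.Ring.Finset
import Mathlib.Data.SetLike.Fintype
import HarnessLib

/-!
# The alternating count of subspaces containing a fixed subspace (Shimura, Lemma 3.23)

Topic `LinearAlgebra/Subspace`. Everything here is proved (Mathlib only); there is no definition
and no named fact.

Let `W` be a finite-dimensional vector space over a finite field `k` with `q = Nat.card k`
elements and `C ≤ W` a subspace. For `j ≥ 0` write `A(C, j) = #{Y : C ≤ Y ≤ W, codim Y = j}`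
(in Lean: `Nat.card {Y : Submodule k W // C ≤ Y ∧ finrank k Y + j = finrank k W}`). The main
result is

`∑_{j = 0}^{dim W} (-1)^j q^{j(j-1)/2} A(C, j) = [C = W]`

(`sum_neg_one_pow_mul_pow_choose_mul_card_ge_codim`, and the case `C ≠ W`,
`sum_neg_one_pow_mul_pow_choose_mul_card_ge_codim_eq_zero`). Since `A(C, j)` is the number
`c^{(m)}_{m-j} = c^{(m)}_j` of `j`-codimensional subspaces of `W / C ≅ k^m` (`m = codim C`), this is
Shimura's Lemma 3.23, `∑_{i=0}^{m} (-1)^i q^{i(i-1)/2} c_i^{(m)} = 0` for `m > 0`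
(*Introduction to the arithmetic theory of automorphic functions* (1971), §3.2, Lemma 3.23,
proved there from the closed form of the Gaussian binomial coefficients by Lagrange
interpolation), i.e. the statement that `μ(C, W) = (-1)^m q^{m(m-1)/2}` is the Möbius function of
the lattice of subspaces (Rota, 1964). It is the combinatorial heart of Tamagawa's rationality
theorem for the Hecke series of `GL_n` (Shimura, Thm. 3.21), which is its consumer in
`Literature/NumberTheory/Automorphic/`.

## Proof

No closed form of the Gaussian binomials is used. Instead:

* `card_isCompl_span_singleton`: for `e ∉ C` the complements `Y ⊇ C` of the line `k e` are the
  kernels of the functionals `φ` with `φ e = 1`, `φ|_C = 0` (`bijective_ker_of_apply_eq_one`), a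
  translate of the annihilator of `C + k e` (`bijective_sub_of_apply_eq_one`), so they number
  `q ^ (dim W - dim C - 1)` (Mathlib `Subspace.finrank_add_finrank_dualAnnihilator_eq`,
  `Module.natCard_eq_pow_finrank`);
* `card_sup_span_singleton_eq`: the same count inside any `P ∋ e` containing `C` (transport along
  `P ↪ W`), i.e. the fibres of `Y ↦ Y + k e` on `{Y ⊇ C : e ∉ Y}` have `q ^ (dim P - dim C - 1)`
  elements;
* `card_ge_codim_eq_add`: hence the recursion
  `A(C, j) = A(C + k e, j) + q^{dim W - dim C - j} A(C + k e, j - 1)` (`j ≥ 1`, `e ∉ C`);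
* the main theorem by induction on `codim C`: the recursion gives
  `S(C) = (1 - q^{dim W - dim C - 1}) S(C + k e)`, and the factor vanishes exactly when `C + k e = W`.

## References

* G. Shimura, *Introduction to the arithmetic theory of automorphic functions*, Publ. Math. Soc.
  Japan 11 (1971), §3.2, Lemma 3.23 with Prop. 3.18 and Thm. 3.21 (read in the 1973 printing
  held in the literature store, `book:shimura1973-introduction-arithmetic-theory-automorphic-functions`,
  PDF pp. 78–83; Lemma 3.23 is on PDF p. 81) [ShimuraIATAF1971].
* G.-C. Rota, *On the foundations of combinatorial theory I. Theory of Möbius functions*,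
  Z. Wahrscheinlichkeitstheorie 2 (1964), 340–368, Example 2 of §5 (the lattice of subspaces).
-/

open Module Submodule Finset

namespace Literature.LinearAlgebra.Subspace

section Field

variable {k W : Type*} [Field k] [AddCommGroup W] [Module k W]

/-! ### Hyperplanes complementary to a line, as kernels of normalised functionals -/

/-- The kernel of a functional `φ` with `φ e = 1` is a complement of the line `k e`. [folklore] -/
theorem isCompl_ker_span_singleton_of_apply_eq_one {φ : Module.Dual k W} {e : W} (h : φ e = 1) :
    IsCompl (LinearMap.ker φ) (k ∙ e) := by
  refine ⟨?_, ?_⟩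
  · rw [disjoint_span_singleton]
    intro he
    rw [LinearMap.mem_ker, h] at he
    exact absurd he one_ne_zero
  · rw [codisjoint_iff, eq_top_iff]
    intro x _
    have hx : x = (x - φ x • e) + φ x • e := by abel
    rw [hx]
    refine Submodule.add_mem_sup ?_ (Submodule.smul_mem _ _ (Submodule.mem_span_singleton_self e))
    rw [LinearMap.mem_ker, map_sub, map_smul, h, smul_eq_mul, mul_one, sub_self]

/-- Two functionals normalised by `φ e = ψ e = 1` with the same kernel coincide. [folklore] -/
theorem eq_of_ker_eq_of_apply_eq_one {φ ψ : Module.Dual k W} {e : W} (hφ : φ e = 1) (hψ : ψ e = 1)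
    (h : LinearMap.ker φ = LinearMap.ker ψ) : φ = ψ := by
  ext x
  have hx : x - φ x • e ∈ LinearMap.ker ψ := by
    rw [← h, LinearMap.mem_ker, map_sub, map_smul, hφ, smul_eq_mul, mul_one, sub_self]
  rw [LinearMap.mem_ker, map_sub, map_smul, hψ, smul_eq_mul, mul_one, sub_eq_zero] at hx
  exact hx.symm

/-- A complement `Y` of the line `k e` (`e ≠ 0`) is the kernel of a functional `φ` with
`φ e = 1`. [folklore] -/
theorem exists_apply_eq_one_and_ker_eq {Y : Submodule k W} {e : W} (he : e ≠ 0)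
    (h : IsCompl Y (k ∙ e)) : ∃ φ : Module.Dual k W, φ e = 1 ∧ LinearMap.ker φ = Y := by
  let c : (k ∙ e) →ₗ[k] k := (LinearEquiv.coord k W e he).toLinearMap
  have hc : ∀ a : k, c ⟨a • e, Submodule.smul_mem _ a (Submodule.mem_span_singleton_self e)⟩ =
      a := by
    intro a
    have h1 := LinearEquiv.coord_apply_smul k W e he
      ⟨a • e, Submodule.smul_mem _ a (Submodule.mem_span_singleton_self e)⟩
    exact smul_left_injective k he h1
  refine ⟨LinearMap.ofIsCompl h 0 c, ?_, ?_⟩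
  · have := LinearMap.ofIsCompl_apply_right h (φ := (0 : Y →ₗ[k] k)) (ψ := c)
      ⟨(1 : k) • e, Submodule.smul_mem _ _ (Submodule.mem_span_singleton_self e)⟩
    rw [hc 1] at this
    simpa using this
  · apply le_antisymm
    · intro x hx
      rw [LinearMap.mem_ker] at hx
      have hx' : x ∈ Y ⊔ (k ∙ e) := by rw [h.sup_eq_top]; exact Submodule.mem_top
      obtain ⟨y, hy, z, hz, rfl⟩ := Submodule.mem_sup.mp hx'
      obtain ⟨a, rfl⟩ := Submodule.mem_span_singleton.mp hz
      have h1 := LinearMap.ofIsCompl_apply_left h (φ := (0 : Y →ₗ[k] k)) (ψ := c) ⟨y, hy⟩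
      have h2 := LinearMap.ofIsCompl_apply_right h (φ := (0 : Y →ₗ[k] k)) (ψ := c)
        ⟨a • e, Submodule.smul_mem _ a (Submodule.mem_span_singleton_self e)⟩
      rw [hc a] at h2
      simp only [map_add, LinearMap.zero_apply] at hx h1
      rw [h1, zero_add] at hx
      change LinearMap.ofIsCompl h 0 c (a • e) = a at h2
      rw [h2] at hx
      rw [hx, zero_smul, add_zero]
      exact hy
    · intro y hy
      rw [LinearMap.mem_ker]
      have h1 := LinearMap.ofIsCompl_apply_left h (φ := (0 : Y →ₗ[k] k)) (ψ := c) ⟨y, hy⟩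
      simpa using h1

/-- **Complements of a line containing a subspace ↔ normalised functionals killing it.** For
`e ≠ 0` and a subspace `C`, the kernel map is a bijection from the functionals `φ` with
`φ e = 1` and `φ|_C = 0` onto the complements `Y ⊇ C` of the line `k e`. [folklore] -/
theorem bijective_ker_of_apply_eq_one (C : Submodule k W) {e : W} (he : e ≠ 0) :
    Function.Bijective (fun φ : {φ : Module.Dual k W // φ e = 1 ∧ C ≤ LinearMap.ker φ} =>
      (⟨LinearMap.ker φ.1, φ.2.2, isCompl_ker_span_singleton_of_apply_eq_one φ.2.1⟩ :
        {Y : Submodule k W // C ≤ Y ∧ IsCompl Y (k ∙ e)})) := by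
  constructor
  · rintro ⟨φ, hφ1, hφC⟩ ⟨ψ, hψ1, hψC⟩ h
    simp only [Subtype.mk.injEq] at h
    exact Subtype.ext (eq_of_ker_eq_of_apply_eq_one hφ1 hψ1 h)
  · rintro ⟨Y, hCY, hY⟩
    obtain ⟨φ, hφ1, hφY⟩ := exists_apply_eq_one_and_ker_eq he hY
    exact ⟨⟨φ, hφ1, hφY ▸ hCY⟩, Subtype.ext hφY⟩

/-- There is a functional `φ` with `φ e = 1` vanishing on a subspace `C ∌ e`. [folklore] -/
theorem exists_apply_eq_one_le_ker {C : Submodule k W} {e : W} (he : e ∉ C) :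
    ∃ φ : Module.Dual k W, φ e = 1 ∧ C ≤ LinearMap.ker φ := by
  obtain ⟨f, hf, hfC⟩ := C.exists_dual_map_eq_bot_of_notMem he inferInstance
  refine ⟨(f e)⁻¹ • f, ?_, fun c hc => ?_⟩
  · rw [LinearMap.smul_apply, smul_eq_mul, inv_mul_cancel₀ hf]
  · rw [LinearMap.mem_ker, LinearMap.smul_apply, smul_eq_mul, mul_eq_zero]
    right
    have : f c ∈ C.map f := Submodule.mem_map_of_mem hc
    rwa [hfC, Submodule.mem_bot] at this

/-- The normalised functionals killing `C` form a translate of the annihilator of `C + k e`: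
subtracting a base point is a bijection. [folklore] -/
theorem bijective_sub_of_apply_eq_one {C : Submodule k W} {e : W} {φ₀ : Module.Dual k W}
    (h₀ : φ₀ e = 1 ∧ C ≤ LinearMap.ker φ₀) :
    Function.Bijective (fun φ : {φ : Module.Dual k W // φ e = 1 ∧ C ≤ LinearMap.ker φ} =>
      (⟨φ.1 - φ₀, by
        rw [Submodule.mem_dualAnnihilator]
        intro w hw
        obtain ⟨c, hc, z, hz, rfl⟩ := Submodule.mem_sup.mp hw
        obtain ⟨a, rfl⟩ := Submodule.mem_span_singleton.mp hz
        have h1 : φ.1 c = 0 := φ.2.2 hc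
        have h2 : φ₀ c = 0 := h₀.2 hc
        simp [h1, h2, φ.2.1, h₀.1]⟩ : (C ⊔ (k ∙ e)).dualAnnihilator)) := by
  constructor
  · rintro ⟨φ, hφ⟩ ⟨ψ, hψ⟩ h
    simp only [Subtype.mk.injEq, sub_left_inj] at h
    exact Subtype.ext h
  · rintro ⟨α, hα⟩
    rw [Submodule.mem_dualAnnihilator] at hα
    refine ⟨⟨α + φ₀, ?_, fun c hc => ?_⟩, ?_⟩
    · rw [LinearMap.add_apply, h₀.1, hα e (Submodule.mem_sup_right (mem_span_singleton_self e)),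
        zero_add]
    · rw [LinearMap.mem_ker, LinearMap.add_apply, hα c (Submodule.mem_sup_left hc),
        show φ₀ c = 0 from h₀.2 hc, add_zero]
    · simp

/-- `dim (C + k e) = dim C + 1` for `e ∉ C`. [folklore] -/
theorem finrank_sup_span_singleton {C : Submodule k W} [FiniteDimensional k C] {e : W}
    (he : e ∉ C) : finrank k ↥(C ⊔ (k ∙ e)) = finrank k C + 1 := by
  have he0 : e ≠ 0 := fun h => he (h ▸ C.zero_mem)
  have h := Submodule.finrank_sup_add_finrank_inf_eq C (k ∙ e)
  have hinf : C ⊓ (k ∙ e) = ⊥ := disjoint_iff.mp (disjoint_span_singleton.mpr fun h => absurd h he)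
  rw [hinf, finrank_bot, add_zero, finrank_span_singleton he0] at h
  exact h

end Field

/-! ### Counting over a finite field -/

section Count

variable {k W : Type*} [Field k] [AddCommGroup W] [Module k W] [FiniteDimensional k W]

/-- **The number of complements of a line containing a given subspace.** Over a field with
`q = Nat.card k` elements, a subspace `C` of a finite-dimensional space `W` and a vector `e ∉ C`:
the complements `Y ⊇ C` of the line `k e` number `q ^ (dim W - dim C - 1)` (they correspond to
the functionals `φ` with `φ e = 1`, `φ|_C = 0`, a translate of the annihilator of `C + k e`).
[folklore] -/
theorem card_isCompl_span_singleton (C : Submodule k W) {e : W} (he : e ∉ C) :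
    Nat.card {Y : Submodule k W // C ≤ Y ∧ IsCompl Y (k ∙ e)} =
      Nat.card k ^ (finrank k W - finrank k C - 1) := by
  have he0 : e ≠ 0 := fun h => he (h ▸ C.zero_mem)
  obtain ⟨φ₀, h₀⟩ := exists_apply_eq_one_le_ker he
  rw [← Nat.card_eq_of_bijective _ (bijective_ker_of_apply_eq_one C he0),
    Nat.card_eq_of_bijective _ (bijective_sub_of_apply_eq_one h₀),
    Module.natCard_eq_pow_finrank (K := k)]
  congr 1
  have h1 := Subspace.finrank_add_finrank_dualAnnihilator_eq (C ⊔ (k ∙ e))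
  rw [finrank_sup_span_singleton he] at h1
  omega

/-- **Fibre count.** For `C ≤ P` and `e ∈ P ∖ C`, the subspaces `Y ⊇ C` with `e ∉ Y` and
`Y + k e = P` number `q ^ (dim P - dim C - 1)`. [folklore] -/
theorem card_sup_span_singleton_eq (C P : Submodule k W) (hCP : C ≤ P) {e : W} (he : e ∈ P)
    (heC : e ∉ C) :
    Nat.card {Y : Submodule k W // C ≤ Y ∧ e ∉ Y ∧ Y ⊔ (k ∙ e) = P} =
      Nat.card k ^ (finrank k P - finrank k C - 1) := by
  -- transport to `P`: restriction `Y ↦ Y ∩ P` (as a subspace of `P`) is a bijection onto the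
  -- complements `Y' ⊇ C|_P` of the line `k e` inside `P`, with inverse `Y' ↦ Y'` (viewed in `W`)
  have hcard : Nat.card {Y : Submodule k W // C ≤ Y ∧ e ∉ Y ∧ Y ⊔ (k ∙ e) = P} =
      Nat.card {Y' : Submodule k P //
        C.comap P.subtype ≤ Y' ∧ IsCompl Y' (k ∙ (⟨e, he⟩ : P))} := by
    refine Nat.card_congr
      { toFun := fun Y => ⟨Y.1.comap P.subtype, Submodule.comap_mono Y.2.1, ?_⟩
        invFun := fun Y' => ⟨Y'.1.map P.subtype, ?_⟩
        left_inv := fun Y => ?_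
        right_inv := fun Y' => ?_ }
    · refine ⟨disjoint_span_singleton.mpr fun h => absurd h Y.2.2.1, ?_⟩
      rw [codisjoint_iff, eq_top_iff]
      rintro ⟨x, hx⟩ -
      have hx' : x ∈ Y.1 ⊔ (k ∙ e) := by rw [Y.2.2.2]; exact hx
      obtain ⟨y, hy, z, hz, rfl⟩ := Submodule.mem_sup.mp hx'
      obtain ⟨a, rfl⟩ := Submodule.mem_span_singleton.mp hz
      have hyP : y ∈ P := by
        have : y + a • e - a • e ∈ P := P.sub_mem hx (P.smul_mem a he)
        rwa [add_sub_cancel_right] at this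
      have e1 : (⟨y + a • e, hx⟩ : P) = ⟨y, hyP⟩ + a • ⟨e, he⟩ := rfl
      rw [e1]
      exact Submodule.add_mem_sup (show (⟨y, hyP⟩ : P) ∈ Y.1.comap P.subtype from hy)
        (Submodule.smul_mem _ a (Submodule.mem_span_singleton_self _))
    · refine ⟨fun c hc => ⟨⟨c, hCP hc⟩, Y'.2.1 hc, rfl⟩, fun h => ?_, ?_⟩
      · obtain ⟨⟨y, hy⟩, hyY, hye⟩ := h
        have hye' : (⟨y, hy⟩ : P) = ⟨e, he⟩ := Subtype.ext hye
        rw [hye'] at hyY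
        have h0 : (⟨e, he⟩ : P) = 0 := disjoint_span_singleton.mp Y'.2.2.1 hyY
        exact heC (by rw [show e = 0 from congrArg Subtype.val h0]; exact C.zero_mem)
      · have hmap : (k ∙ e) = (k ∙ (⟨e, he⟩ : P)).map P.subtype := by
          rw [Submodule.map_span, Set.image_singleton, Submodule.subtype_apply]
        rw [hmap, ← Submodule.map_sup, Y'.2.2.sup_eq_top, Submodule.map_subtype_top]
    · apply Subtype.ext
      simp only
      rw [Submodule.map_comap_subtype, inf_eq_right]
      exact le_sup_left.trans Y.2.2.2.le
    · apply Subtype.ext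
      simp only
      exact Submodule.comap_map_eq_of_injective P.injective_subtype _
  rw [hcard, card_isCompl_span_singleton _ (by exact heC)]
  congr 2
  rw [(Submodule.comapSubtypeEquivOfLe hCP).finrank_eq]

end Count

/-! ### The recursion in the codimension-graded counts -/

section Recursion

variable {k W : Type*} [Field k] [AddCommGroup W] [Module k W] [FiniteDimensional k W]

/-- Splitting a finite subtype along a predicate. [folklore] -/
theorem card_subtype_and_add_card_subtype_and_not {α : Type*} [Finite α] (p r : α → Prop) :
    Nat.card {x // p x ∧ r x} + Nat.card {x // p x ∧ ¬ r x} = Nat.card {x // p x} := by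
  classical
  rw [← Nat.card_sum]
  refine Nat.card_congr ?_
  exact ((Equiv.subtypeSubtypeEquivSubtypeInter p r).symm.sumCongr
    (Equiv.subtypeSubtypeEquivSubtypeInter p (fun x => ¬ r x)).symm).trans
      (Equiv.sumCompl fun y : {x // p x} => r y.1)

/-- Only `Y = ⊤` contains `C` with codimension `0`. [folklore] -/
theorem card_ge_codim_zero (C : Submodule k W) :
    Nat.card {Y : Submodule k W // C ≤ Y ∧ finrank k Y + 0 = finrank k W} = 1 := by
  rw [Nat.card_eq_one_iff_unique]
  refine ⟨⟨fun Y Y' => Subtype.ext ?_⟩, ⟨⟨⊤, le_top, by rw [add_zero, finrank_top]⟩⟩⟩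
  have h1 : Y.1 = ⊤ := Submodule.eq_top_of_finrank_eq (by simpa using Y.2.2)
  have h2 : Y'.1 = ⊤ := Submodule.eq_top_of_finrank_eq (by simpa using Y'.2.2)
  rw [h1, h2]

/-- No subspace containing `C` has codimension exceeding `dim W - dim C`. [folklore] -/
theorem card_ge_codim_eq_zero (C : Submodule k W) {j : ℕ} (hj : finrank k W < finrank k C + j) :
    Nat.card {Y : Submodule k W // C ≤ Y ∧ finrank k Y + j = finrank k W} = 0 := by
  rw [Nat.card_eq_zero]
  left
  refine ⟨fun Y => ?_⟩
  have h1 : finrank k C ≤ finrank k Y.1 := Submodule.finrank_mono Y.2.1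
  have h2 := Y.2.2
  omega

variable [Finite k]

/-- **Recursion.** For `e ∉ C` and `j ≥ 1`, the subspaces `Y ⊇ C` of codimension `j` are those
containing `e` (i.e. `Y ⊇ C + k e`) together with, for each `P ⊇ C + k e` of codimension
`j - 1`, the `q ^ (dim W - dim C - j)` subspaces `Y ∌ e` with `Y + k e = P`. [folklore] -/
theorem card_ge_codim_eq_add (C : Submodule k W) {e : W} (he : e ∉ C) {j : ℕ} (hj : 1 ≤ j) :
    Nat.card {Y : Submodule k W // C ≤ Y ∧ finrank k Y + j = finrank k W} =
      Nat.card {Y : Submodule k W // C ⊔ (k ∙ e) ≤ Y ∧ finrank k Y + j = finrank k W} +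
        Nat.card k ^ (finrank k W - finrank k C - j) *
          Nat.card {P : Submodule k W // C ⊔ (k ∙ e) ≤ P ∧ finrank k P + (j - 1) = finrank k W} := by
  classical
  haveI : Finite W := Module.finite_of_finite k
  rw [← card_subtype_and_add_card_subtype_and_not _ (fun Y : Submodule k W => e ∈ Y)]
  congr 1
  · refine Nat.card_congr (Equiv.subtypeEquivRight fun Y => ?_)
    rw [sup_le_iff, Submodule.span_singleton_le_iff_mem]
    tauto
  · -- the subspaces not containing `e`, fibred over `P = Y + k e`
    set p : Submodule k W → Prop := fun P =>
      C ⊔ (k ∙ e) ≤ P ∧ finrank k P + (j - 1) = finrank k W with hp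
    set α := {Y : Submodule k W // (C ≤ Y ∧ finrank k Y + j = finrank k W) ∧ ¬ e ∈ Y} with hα
    have hf : ∀ Y : α, p (Y.1 ⊔ (k ∙ e)) := by
      rintro ⟨Y, ⟨hCY, hY⟩, heY⟩
      refine ⟨sup_le_sup_right hCY _, ?_⟩
      rw [finrank_sup_span_singleton heY]
      omega
    haveI : Fintype (Subtype p) := Fintype.ofFinite _
    rw [← Nat.card_congr (Equiv.sigmaSubtypeFiberEquiv (fun Y : α => Y.1 ⊔ (k ∙ e)) p hf),
      Nat.card_sigma]
    have hfib : ∀ P : Subtype p, Nat.card {Y : α // Y.1 ⊔ (k ∙ e) = P} =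
        Nat.card k ^ (finrank k W - finrank k C - j) := by
      rintro ⟨P, hP1, hP2⟩
      have heP : e ∈ P := hP1 (Submodule.mem_sup_right (Submodule.mem_span_singleton_self e))
      have hCP : C ≤ P := le_sup_left.trans hP1
      have hcount := card_sup_span_singleton_eq C P hCP heP he
      have hexp : finrank k P - finrank k C - 1 = finrank k W - finrank k C - j := by
        have : finrank k C + 1 ≤ finrank k P := by
          rw [← finrank_sup_span_singleton he]
          exact Submodule.finrank_mono hP1
        omega
      rw [hexp] at hcount
      rw [← hcount]
      refine Nat.card_congr ⟨fun Y => ⟨Y.1.1, Y.1.2.1.1, Y.1.2.2, Y.2⟩,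
        fun Y => ⟨⟨Y.1, ⟨Y.2.1, ?_⟩, Y.2.2.1⟩, Y.2.2.2⟩, fun Y => rfl, fun Y => rfl⟩
      have h1 := finrank_sup_span_singleton (k := k) Y.2.2.1
      rw [Y.2.2.2] at h1
      omega
    simp_rw [hfib]
    rw [Finset.sum_const, Finset.card_univ, smul_eq_mul, ← Nat.card_eq_fintype_card, mul_comm]

end Recursion

/-! ### The alternating sum (Shimura, Lemma 3.23) -/

section Alternating

variable {k W : Type*} [Field k] [Finite k] [AddCommGroup W] [Module k W] [FiniteDimensional k W]

/-- **Shimura's Lemma 3.23 / the Möbius function of the lattice of subspaces.** Over a finite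
field with `q` elements, for every subspace `C` of a finite-dimensional space `W`,
`∑_j (-1)^j q^{j(j-1)/2} #{Y ⊇ C : codim Y = j} = [C = W]`. For `C` of codimension `m ≥ 1` the
count `#{Y ⊇ C : codim Y = j}` is the number `c_{m-j}^{(m)} = c_j^{(m)}` of `j`-codimensional
subspaces of `W/C ≅ 𝔽_q^m`, and the statement is Shimura's `∑_i (-1)^i q^{i(i-1)/2} c_i^{(m)} = 0`
(*Introduction to the arithmetic theory of automorphic functions* (1971), Lemma 3.23, proved there by
Lagrange interpolation; equivalently `μ(C, W) = (-1)^m q^{m(m-1)/2}` is the Möbius function of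
the subspace lattice, Rota (1964)). Proof here: induction on the codimension through the recursion
`card_ge_codim_eq_add`, which gives `S(C) = (1 - q^{dim W - dim C - 1}) S(C + k e)` for `e ∉ C`.
[cite: ShimuraIATAF1971, Lemma 3.23] -/
theorem sum_neg_one_pow_mul_pow_choose_mul_card_ge_codim (C : Submodule k W) :
    ∑ j ∈ Finset.range (finrank k W + 1), (-1 : ℤ) ^ j * (Nat.card k : ℤ) ^ (j.choose 2) *
        (Nat.card {Y : Submodule k W // C ≤ Y ∧ finrank k Y + j = finrank k W} : ℤ) =
      if C = ⊤ then 1 else 0 := by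
  -- strong induction on the codimension of `C`
  suffices h : ∀ (d : ℕ) (C : Submodule k W), finrank k W - finrank k C = d →
      ∑ j ∈ Finset.range (finrank k W + 1), (-1 : ℤ) ^ j * (Nat.card k : ℤ) ^ (j.choose 2) *
        (Nat.card {Y : Submodule k W // C ≤ Y ∧ finrank k Y + j = finrank k W} : ℤ) =
      if C = ⊤ then 1 else 0 from h _ C rfl
  intro d
  induction d using Nat.strong_induction_on with
  | _ d ih =>
  intro C hd
  set n := finrank k W with hn
  set q : ℤ := (Nat.card k : ℤ) with hq
  by_cases hC : C = ⊤
  · -- only `j = 0` contributes, with the single subspace `Y = ⊤`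
    subst hC
    rw [if_pos rfl, Finset.sum_range_succ', card_ge_codim_zero]
    rw [Finset.sum_eq_zero fun j _ => ?_]
    · simp
    · rw [card_ge_codim_eq_zero ⊤ (by rw [finrank_top]; omega)]
      simp
  rw [if_neg hC]
  -- a vector outside `C`
  obtain ⟨e, he⟩ : ∃ e : W, e ∉ C := by
    by_contra! h
    exact hC (eq_top_iff.mpr fun x _ => h x)
  have he0 : e ≠ 0 := fun h => he (h ▸ C.zero_mem)
  set C' := C ⊔ (k ∙ e) with hC'
  have hdimC' : finrank k C' = finrank k C + 1 := finrank_sup_span_singleton he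
  have hCn : finrank k C + 1 ≤ n := by
    rw [← hdimC', hn, ← finrank_top (R := k) (M := W)]
    exact Submodule.finrank_mono le_top
  -- the induction hypothesis for `C'`
  have ih' := ih (n - finrank k C') (by omega) C' rfl
  -- abbreviations for the graded counts
  set A : ℕ → ℤ := fun j =>
    (Nat.card {Y : Submodule k W // C ≤ Y ∧ finrank k Y + j = n} : ℤ) with hA
  set A' : ℕ → ℤ := fun j =>
    (Nat.card {Y : Submodule k W // C' ≤ Y ∧ finrank k Y + j = n} : ℤ) with hA'
  -- the recursion, termwise, for `j + 1`
  have hrec : ∀ j, A (j + 1) = A' (j + 1) + q ^ (n - finrank k C - (j + 1)) * A' j := by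
    intro j
    simp only [hA, hA', hq]
    rw [card_ge_codim_eq_add C he (Nat.le_add_left 1 j), Nat.add_sub_cancel]
    push_cast
    ring
  -- vanishing of `A' j` beyond the maximal codimension `n - dim C - 1`
  have hA'0 : ∀ j, n - finrank k C - 1 < j → A' j = 0 := by
    intro j hj
    simp only [hA']
    rw [card_ge_codim_eq_zero C' (by omega), Nat.cast_zero]
  have hA'n : A' n = 0 := hA'0 n (by omega)
  -- `S(C) = S(C') - q^{n - dim C - 1} S(C')`
  have hS' : ∑ j ∈ Finset.range (n + 1), (-1 : ℤ) ^ j * q ^ (j.choose 2) * A' j =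
      ∑ j ∈ Finset.range n, (-1 : ℤ) ^ j * q ^ (j.choose 2) * A' j := by
    rw [Finset.sum_range_succ, hA'n, mul_zero, add_zero]
  have key : ∑ j ∈ Finset.range (n + 1), (-1 : ℤ) ^ j * q ^ (j.choose 2) * A j =
      (1 - q ^ (n - finrank k C - 1)) *
        ∑ j ∈ Finset.range (n + 1), (-1 : ℤ) ^ j * q ^ (j.choose 2) * A' j := by
    rw [Finset.sum_range_succ' _ n, Finset.sum_range_succ' (fun j => (-1 : ℤ) ^ j * _ * A' j) n]
    have h0 : A 0 = 1 := by simp only [hA]; rw [card_ge_codim_zero]; simp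
    have h0' : A' 0 = 1 := by simp only [hA']; rw [card_ge_codim_zero]; simp
    simp only [h0, h0', pow_zero, Nat.choose_zero_succ, mul_one]
    have hterm : ∀ j ∈ Finset.range n, (-1 : ℤ) ^ (j + 1) * q ^ ((j + 1).choose 2) * A (j + 1) =
        (-1 : ℤ) ^ (j + 1) * q ^ ((j + 1).choose 2) * A' (j + 1) -
          q ^ (n - finrank k C - 1) * ((-1 : ℤ) ^ j * q ^ (j.choose 2) * A' j) := by
      intro j _
      rw [hrec j]
      by_cases hj : j ≤ n - finrank k C - 1
      · have e1 : (j + 1).choose 2 = j.choose 2 + j := by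
          rw [Nat.choose_succ_left _ _ (by norm_num : 0 < 2), Nat.choose_one_right]; ring
        have hpow : q ^ ((j + 1).choose 2) * q ^ (n - finrank k C - (j + 1)) =
            q ^ (n - finrank k C - 1) * q ^ (j.choose 2) := by
          rw [e1, ← pow_add, ← pow_add]
          congr 1
          omega
        calc (-1 : ℤ) ^ (j + 1) * q ^ ((j + 1).choose 2) *
              (A' (j + 1) + q ^ (n - finrank k C - (j + 1)) * A' j)
            = (-1 : ℤ) ^ (j + 1) * q ^ ((j + 1).choose 2) * A' (j + 1) +
                (-1 : ℤ) ^ (j + 1) * (q ^ ((j + 1).choose 2) * q ^ (n - finrank k C - (j + 1))) *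
                  A' j := by ring
          _ = (-1 : ℤ) ^ (j + 1) * q ^ ((j + 1).choose 2) * A' (j + 1) +
                (-1 : ℤ) ^ (j + 1) * (q ^ (n - finrank k C - 1) * q ^ (j.choose 2)) * A' j := by
              rw [hpow]
          _ = _ := by ring
      · rw [hA'0 j (by omega), mul_zero, mul_zero, mul_zero, add_zero, sub_zero]
    rw [Finset.sum_congr rfl hterm, Finset.sum_sub_distrib, ← Finset.mul_sum, ← hS',
      Finset.sum_range_succ' (fun j => (-1 : ℤ) ^ j * _ * A' j) n]
    simp only [h0', pow_zero, Nat.choose_zero_succ, mul_one]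
    ring
  change ∑ j ∈ Finset.range (n + 1), (-1 : ℤ) ^ j * q ^ (j.choose 2) * A j = 0
  rw [key, ih']
  by_cases hC't : C' = ⊤
  · have : n - finrank k C - 1 = 0 := by
      have h1 : finrank k C' = n := by rw [hC't, finrank_top]
      omega
    rw [if_pos hC't, this, pow_zero, sub_self, zero_mul]
  · rw [if_neg hC't, mul_zero]

/-- **Corollary (the form used for Tamagawa's Hecke identity).** For a *proper* subspace `C`:
`∑_j (-1)^j q^{j(j-1)/2} #{Y ⊇ C : codim Y = j} = 0`. [cite: ShimuraIATAF1971, Lemma 3.23] -/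
theorem sum_neg_one_pow_mul_pow_choose_mul_card_ge_codim_eq_zero {C : Submodule k W}
    (hC : C ≠ ⊤) :
    ∑ j ∈ Finset.range (finrank k W + 1), (-1 : ℤ) ^ j * (Nat.card k : ℤ) ^ (j.choose 2) *
        (Nat.card {Y : Submodule k W // C ≤ Y ∧ finrank k Y + j = finrank k W} : ℤ) = 0 := by
  rw [sum_neg_one_pow_mul_pow_choose_mul_card_ge_codim, if_neg hC]

end Alternating

end Literature.LinearAlgebra.Subspace
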